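/-
Copyright (c) 2026 the pub-hodgecm-mathlib formalisation cell (harness21).  Prover seat hodgecm-mathlib-LH3-p01 (g7); dealer LH4-plan (g7) WORD #18∕#24 «(U2)»,
2026-09-02.  Count-neutral uniform supplier of the ROW-2 column (CENSUS-C6 196c9bc3 §0.3′ (U2); FINDINGS #6∕#6′∕#15 of the LH4 board).
-/
import Literature.NumberTheory.Automorphic.SplitTorusOrderFixedSidePlace    -- ★ Σ2-CM: the place dictionary §1–§2 (`toPlace`, `ιO`, `hfixO`, `hmove`, `hq`, `|𝓀[F_v]| = N(v)`); brings ★ O8a-5Σ, ★ Σ2-F, ★ O3∕O4, ★ O8a-5E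
import HarnessLib

/-!
# The split-torus order at a non-split place WITHOUT `|2| = 1`: σ-descent through a ring GENERATOR, `[𝒪_Fⁿ : R^σ]² = [𝒪_Eⁿ : R]`, and the composed unit index
# `[C : R^×] = (N(v) + 1)^{n−1} · N(v)^{S−(n−1)}` at EVERY inert-unramified place (Serre, *Local Fields*, Ch. V §2, Ch. X §1; Neukirch, *ANT*, Ch. I §12)

Topic `NumberTheory/Automorphic`; namespace `Literature.NumberTheory.Automorphic`.  THEOREMS ONLY (no definition, no instance, no notation, no named fact, no `sorry`);
count-neutral; kernel lane `--supports stmt-HodgeConjecture-24833`.  Cell `pub/hodgecm-mathlib`, crux H413 = `stmt-HodgeConjecture-24833`; LH4 board (D-UNR) (C6) «readers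
in the trace frame», uniform supplier **(U2)** of CENSUS-C6 196c9bc3 §0.3′ (LH3-p02 (g6)); dealer LH4-plan (g7) WORD #18 (U2), WORD #24.
WHERE `|2| = 1` SAT in ★ `SplitTorusOrderFixedSidePlace.relIndex_units_adjoin_comap_norm_eq_place (h2 : |2|_w = 1)`: ONLY in ★ O3 (b) `relIndex_inf_fixed_sq_eq_relIndex (h2) (δ)`
— the σ-descent `M = M^σ ⊕ δ·M^σ` (`y = ½(x + σx)`, `z = (x − σx)∕2δ`) behind ★ Σ2-F (c) `index_comap_adjoin_sq`, called once by ★ O8a-5Σ (:204); ★ Σ2-F (a)(b)(d), ★ O8a-5E,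
★ O1∕O2, ★ O4 are 2-free and read the INERT token `hmove : ∃ a ∈ 𝒪_E, σa − a ∈ 𝒪_E^×` only.  THE 2-FREE ROUTE: descend through any `g ∈ O` with `σg − g ∈ O^×` —
**`M = M^σ ⊕ g·M^σ`**, `z = (σx − x)∕(σg − g)`, `y = x − g·z` (σ-fixed since `σ(σg − g) = −(σg − g)`) — i.e. through `hmove`'s witness, which exists at every inert-UNRAMIFIED
place in every residue characteristic (★ `exists_isUnit_galAdicCompletionMap_sub`: the residual Frobenius moves something), whereas a skew UNIT and `½ ∈ 𝒪` fail at `v ∣ 2`.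
So the place head is ★'s with `(h2 : Valued.v (2 : E_w) = 1)` DELETED and NOTHING added; the value is VERBATIM (FINDING #15: ROW 2 persists at `v ∣ 2`).  The multiplicative
sibling (`u = a + c·g ⇒ |u∕σu − 1| = |c|`, Hilbert 90 unit form) is ★ `LocalFields/UnramifiedQuadraticNormOneUnitIndex` (LH5-p01, p851897); the additive descent here needs no valuation.
* §1 (field `K`, involution `σ`, subring `O`, generator `g`): `exists_fixed_add_smul_fixed_of_isUnit_sub`, `fixed_add_smul_fixed_unique_of_sub_ne_zero`,
  **`relIndex_inf_fixed_sq_eq_relIndex_of_isUnit_sub`** (★ O3 (a)(b) with `(h2)(δ)(hδ)(hσδ) ↦ (g)(hg)`).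
* §2 (★ Σ2-F's two-field currency `ι, ιO, σ`): `index_comap_adjoin_sq_of_isUnit_sub` (★ Σ2-F (c), `(h2)(δ)(hδ)(hσδ) ↦ hmove`), **`relIndex_units_adjoin_comap_norm_eq_of_isUnit_sub`**
  (★ O8a-5Σ with `(h2)(δ)(hδ)(hσδ)` DELETED — `hmove` was already a binder).
* §3 (place `w ∣ v`, `c • w = w`, `v` unramified in `E`): the (U2) head **`relIndex_units_adjoin_comap_norm_eq_place_of_isUnramifiedIn`** = ★ :239 with `h2` DELETED, binders
  `hc hunr w hw ιO hιO hϖE hn γ N hNpos hN hσγ` + conclusion VERBATIM (the (C6)-2∕-3 ROW-2 readers dock on it by name); Σ2-F (c) at the place = §2 with the same dictionary.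
HONEST READER LABEL: supplier layer; HC_CM is proved only modulo the 7 printed citations (2 remaining named inputs: hLiu418 = stmt-HodgeConjecture-24832, h413 =
stmt-HodgeConjecture-24833) until rung 0 closes; count-neutral ((D-UNR) stays PRINT by D74′), pays no organ, opens no road.

## References
* [Serre1979] J.-P. Serre, *Local Fields*, GTM 67 (1979): Ch. X §1 Prop. 3 (Galois descent), Ch. V §2 Prop. 3 and Corollary (unramified norms; residual Frobenius).
* [Neukirch1999] J. Neukirch, *Algebraic Number Theory* (1999): Ch. I §12 (orders and their unit index), Ch. II §4 Prop. (4.3).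
* [Hungerford1974] T. W. Hungerford, *Algebra*, GTM 73 (1974): Ch. I Thm. 4.5, Thm. 5.11 (index calculus under a surjection).
* [Rogawski1990] J. D. Rogawski, *Automorphic Representations of Unitary Groups in Three Variables* (1990), §4.9 Lemma 4.9.3 p. 56 (where the index is consumed).
-/

set_option autoImplicit false

noncomputable section

open ValuativeRel NumberField IsDedekindDomain Finset
open scoped ValuativeRel

namespace Literature.NumberTheory.Automorphic

/-! ## §1 σ-descent through a ring generator: `M = M^σ ⊕ g·M^σ`, `[Oⁿ : M] = [O_σⁿ : M^σ]²` (no `2`, no skew unit) -/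

section GeneratorDescent

variable {K : Type*} [Field K] (σ : K →+* K) (O : Subring K) {n : ℕ}

/-- **EXISTENCE: `x = y + g•z` with `y, z ∈ M` componentwise σ-fixed**, for `M ≤ Kⁿ` an `O`-submodule stable under componentwise `σ` (`σ² = id`, `σ(O) ⊆ O`) and a GENERATOR
`g ∈ O` with `σg − g ∈ O^×`: `z = (σx − x)∕(σg − g)`, `y = x − g·z` (★ O3 (a) `exists_fixed_add_smul_fixed` had `y = ½(x + σx)`, `z = (x − σx)∕2δ`).
[cite: Serre1979, Ch. X §1 Prop. 3] -/
theorem exists_fixed_add_smul_fixed_of_isUnit_sub (hσσ : ∀ a, σ (σ a) = a) (hσO : ∀ a ∈ O, σ a ∈ O)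
    (g : O) (hg : IsUnit ((⟨σ (g : K), hσO (g : K) g.2⟩ : O) - g))
    (M : Submodule O (Fin n → K)) (hM : ∀ x ∈ M, (fun i => σ (x i)) ∈ M) (x : Fin n → K) (hx : x ∈ M) :
    ∃ y z : Fin n → K, y ∈ M ∧ z ∈ M ∧ (∀ i, σ (y i) = y i) ∧ (∀ i, σ (z i) = z i) ∧ x = y + (g : K) • z := by
  obtain ⟨hd0, hd'⟩ := Literature.RingTheory.GaloisAlgebras.coe_ne_zero_and_inv_mem_of_isUnit O hg
  have hdK : (((⟨σ (g : K), hσO (g : K) g.2⟩ : O) - g : O) : K) = σ (g : K) - (g : K) := rfl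
  rw [hdK] at hd0 hd'
  have hσd : σ (σ (g : K) - (g : K)) = -(σ (g : K) - (g : K)) := by rw [map_sub, hσσ]; ring
  have hσd' : σ (σ (g : K) - (g : K))⁻¹ = -(σ (g : K) - (g : K))⁻¹ := by rw [map_inv₀, hσd, neg_inv]
  have hdd : (σ (g : K) - (g : K)) * (σ (g : K) - (g : K))⁻¹ = 1 := mul_inv_cancel₀ hd0
  -- `z := (σg − g)⁻¹ • (σx − x) ∈ M`, `y := x − g • z ∈ M`
  set z : Fin n → K := fun i => (σ (g : K) - (g : K))⁻¹ * (σ (x i) - x i) with hz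
  have hzM : z ∈ M := by
    have h : z = (⟨(σ (g : K) - (g : K))⁻¹, hd'⟩ : O) • ((fun i => σ (x i)) - x) := by
      funext i; rfl
    rw [h]
    exact M.smul_mem _ (M.sub_mem (hM x hx) hx)
  have hσz : ∀ i, σ (z i) = z i := fun i => by
    simp only [hz, map_mul, map_sub, hσσ, hσd']
    ring
  refine ⟨x - (g : K) • z, z, M.sub_mem hx (M.smul_mem g hzM), hzM, fun i => ?_, hσz, ?_⟩
  · simp only [Pi.sub_apply, Pi.smul_apply, smul_eq_mul, map_sub, map_mul, hσz i]
    simp only [hz]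
    linear_combination (x i - σ (x i)) * hdd
  · funext i
    simp only [Pi.add_apply, Pi.sub_apply, Pi.smul_apply, smul_eq_mul]
    ring

omit O in
/-- **UNIQUENESS**: `y + g•z = y′ + g•z′` with `y, z, y′, z′` componentwise σ-fixed and `σg ≠ g` forces `y = y′`, `z = z′` (apply `σ` and subtract: `(σg − g)(z − z′) = 0`).
[cite: Serre1979, Ch. X §1 Prop. 3] -/
theorem fixed_add_smul_fixed_unique_of_sub_ne_zero {g : K} (hg : σ g - g ≠ 0)
    {y z y' z' : Fin n → K} (hy : ∀ i, σ (y i) = y i) (hz : ∀ i, σ (z i) = z i) (hy' : ∀ i, σ (y' i) = y' i) (hz' : ∀ i, σ (z' i) = z' i)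
    (h : y + g • z = y' + g • z') : y = y' ∧ z = z' := by
  have hpt : ∀ i, y i + g * z i = y' i + g * z' i := fun i => by
    have := congrFun h i
    simpa only [Pi.add_apply, Pi.smul_apply, smul_eq_mul] using this
  have hσpt : ∀ i, y i + σ g * z i = y' i + σ g * z' i := fun i => by
    have := congrArg σ (hpt i)
    rw [map_add, map_add, map_mul, map_mul, hy, hz, hy', hz'] at this
    exact this
  have hzz : ∀ i, z i = z' i := fun i => by
    have h1 := hpt i
    have h2 := hσpt i
    have : (σ g - g) * (z i - z' i) = 0 := by linear_combination h2 - h1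
    rcases mul_eq_zero.1 this with h0 | h0
    · exact absurd h0 hg
    · exact sub_eq_zero.1 h0
  refine ⟨funext fun i => ?_, funext hzz⟩
  have h1 := hpt i
  rw [hzz i] at h1
  exact add_right_cancel h1

/-- **THE INDEX SQUARES THROUGH A GENERATOR: `[Oⁿ : M] = [O_σⁿ : M^σ]²`** — ★ O3 (b) `relIndex_inf_fixed_sq_eq_relIndex` with `(h2 : IsUnit 2) (δ skew unit)` REPLACED by a
generator `g ∈ O`, `σg − g ∈ O^×`.  Tokens VERBATIM: `Oⁿ := AddSubgroup.pi univ (fun _ ↦ O)`, `Fix := eqLocus (componentwise σ) id`, indices `AddSubgroup.relIndex` in `Kⁿ`.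
The additive map `(y, z) ↦ y + g•z : O_σⁿ × O_σⁿ → Oⁿ` is onto (decompose inside `Oⁿ`: `z = (σx − x)∕(σg − g)`, `y = x − g z` are integral and σ-fixed) and pulls `M` back to
`M^σ × M^σ` (existence + uniqueness above). [cite: Serre1979, Ch. X §1 Prop. 3] [cite: Hungerford1974, Ch. I Thm. 4.5, Thm. 5.11] -/
theorem relIndex_inf_fixed_sq_eq_relIndex_of_isUnit_sub (hσσ : ∀ a, σ (σ a) = a) (hσO : ∀ a ∈ O, σ a ∈ O)
    (g : O) (hg : IsUnit ((⟨σ (g : K), hσO (g : K) g.2⟩ : O) - g))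
    (M : Submodule O (Fin n → K)) (hM : ∀ x ∈ M, (fun i => σ (x i)) ∈ M) :
    ((M.toAddSubgroup ⊓ (RingHom.eqLocus (RingHom.pi (fun i => σ.comp (Pi.evalRingHom (fun _ : Fin n => K) i))) (RingHom.id (Fin n → K))).toAddSubgroup).relIndex
        ((AddSubgroup.pi Set.univ fun _ : Fin n => O.toAddSubgroup) ⊓
          (RingHom.eqLocus (RingHom.pi (fun i => σ.comp (Pi.evalRingHom (fun _ : Fin n => K) i))) (RingHom.id (Fin n → K))).toAddSubgroup)) ^ 2 =
      M.toAddSubgroup.relIndex (AddSubgroup.pi Set.univ fun _ : Fin n => O.toAddSubgroup) := by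
  classical
  obtain ⟨hd0, hd'⟩ := Literature.RingTheory.GaloisAlgebras.coe_ne_zero_and_inv_mem_of_isUnit O hg
  have hdK : (((⟨σ (g : K), hσO (g : K) g.2⟩ : O) - g : O) : K) = σ (g : K) - (g : K) := rfl
  rw [hdK] at hd0 hd'
  have hσd : σ (σ (g : K) - (g : K)) = -(σ (g : K) - (g : K)) := by rw [map_sub, hσσ]; ring
  have hσd' : σ (σ (g : K) - (g : K))⁻¹ = -(σ (g : K) - (g : K))⁻¹ := by rw [map_inv₀, hσd, neg_inv]
  have hdd : (σ (g : K) - (g : K)) * (σ (g : K) - (g : K))⁻¹ = 1 := mul_inv_cancel₀ hd0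
  set Fix : AddSubgroup (Fin n → K) :=
    (RingHom.eqLocus (RingHom.pi (fun i => σ.comp (Pi.evalRingHom (fun _ : Fin n => K) i))) (RingHom.id (Fin n → K))).toAddSubgroup with hFix
  set On : AddSubgroup (Fin n → K) := AddSubgroup.pi Set.univ fun _ : Fin n => O.toAddSubgroup with hOn
  set P : AddSubgroup (Fin n → K) := On ⊓ Fix with hP
  set Mσ : AddSubgroup (Fin n → K) := M.toAddSubgroup ⊓ Fix with hMσ
  have memFix : ∀ x : Fin n → K, x ∈ Fix ↔ ∀ i, σ (x i) = x i := fun x => by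
    rw [hFix, Subring.mem_toAddSubgroup, RingHom.mem_eqLocus]
    exact ⟨fun h i => by simpa using congrFun h i, fun h => funext fun i => by simpa using h i⟩
  have memOn : ∀ x : Fin n → K, x ∈ On ↔ ∀ i, x i ∈ O := fun x => by
    rw [hOn, AddSubgroup.mem_pi]; simp
  -- the decomposition inside `Oⁿ`: `z = (σg − g)⁻¹(σx − x)`, `y = x − g z`
  have decO : ∀ x ∈ On, ∃ y z : Fin n → K, y ∈ P ∧ z ∈ P ∧ x = y + (g : K) • z := by
    intro x hx
    rw [memOn] at hx
    have hzO : ∀ i, (σ (g : K) - (g : K))⁻¹ * (σ (x i) - x i) ∈ O := fun i => O.mul_mem hd' (O.sub_mem (hσO _ (hx i)) (hx i))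
    have hσz : ∀ i, σ ((σ (g : K) - (g : K))⁻¹ * (σ (x i) - x i)) = (σ (g : K) - (g : K))⁻¹ * (σ (x i) - x i) := fun i => by
      simp only [map_mul, map_sub, hσσ, hσd']; ring
    refine ⟨fun i => x i - (g : K) * ((σ (g : K) - (g : K))⁻¹ * (σ (x i) - x i)), fun i => (σ (g : K) - (g : K))⁻¹ * (σ (x i) - x i), ?_, ?_, ?_⟩
    · rw [hP, AddSubgroup.mem_inf, memOn, memFix]
      refine ⟨fun i => O.sub_mem (hx i) (O.mul_mem g.2 (hzO i)), fun i => ?_⟩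
      rw [map_sub, map_mul, hσz i]
      linear_combination (x i - σ (x i)) * hdd
    · rw [hP, AddSubgroup.mem_inf, memOn, memFix]
      exact ⟨hzO, hσz⟩
    · funext i
      simp only [Pi.add_apply, Pi.smul_apply, smul_eq_mul]
      ring
  -- the restricted map `Ψ : P × P →+ On`, `(y, z) ↦ y + g z`
  have hPO : ∀ y ∈ P, ∀ z ∈ P, y + (g : K) • z ∈ On := by
    intro y hy z hz
    rw [hP, AddSubgroup.mem_inf, memOn] at hy hz
    rw [memOn]
    intro i
    simp only [Pi.add_apply, Pi.smul_apply, smul_eq_mul]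
    exact O.add_mem (hy.1 i) (O.mul_mem g.2 (hz.1 i))
  let Ψ : ↥P × ↥P →+ ↥On :=
    { toFun := fun yz => ⟨(yz.1 : Fin n → K) + (g : K) • (yz.2 : Fin n → K), hPO _ yz.1.2 _ yz.2.2⟩
      map_zero' := by ext i; simp
      map_add' := fun a b => by
        ext i
        simp only [Prod.fst_add, Prod.snd_add, AddSubgroup.coe_add, Pi.add_apply, Pi.smul_apply, smul_eq_mul, smul_add]
        ring }
  have hΨ : ∀ yz : ↥P × ↥P, ((Ψ yz : ↥On) : Fin n → K) = (yz.1 : Fin n → K) + (g : K) • (yz.2 : Fin n → K) := fun _ => rfl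
  have hΨsurj : Function.Surjective Ψ := by
    rintro ⟨x, hx⟩
    obtain ⟨y, z, hy, hz, hxyz⟩ := decO x hx
    exact ⟨(⟨y, hy⟩, ⟨z, hz⟩), Subtype.ext (by rw [hΨ]; exact hxyz.symm)⟩
  -- `Ψ⁻¹(M) = Mσ × Mσ`
  have hfixP : ∀ y : Fin n → K, y ∈ P → ∀ i, σ (y i) = y i := fun y hy => by
    rw [hP, AddSubgroup.mem_inf, memFix] at hy
    exact hy.2
  have hcomap : (M.toAddSubgroup.addSubgroupOf On).comap Ψ = (Mσ.addSubgroupOf P).prod (Mσ.addSubgroupOf P) := by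
    ext yz
    rw [AddSubgroup.mem_comap, AddSubgroup.mem_addSubgroupOf, hΨ, AddSubgroup.mem_prod, AddSubgroup.mem_addSubgroupOf, AddSubgroup.mem_addSubgroupOf,
      hMσ, AddSubgroup.mem_inf, AddSubgroup.mem_inf, Submodule.mem_toAddSubgroup, Submodule.mem_toAddSubgroup, Submodule.mem_toAddSubgroup, memFix, memFix]
    constructor
    · intro h
      obtain ⟨y', z', hy', hz', hfy', hfz', hdec⟩ := exists_fixed_add_smul_fixed_of_isUnit_sub σ O hσσ hσO g hg M hM _ h
      obtain ⟨hyy, hzz⟩ := fixed_add_smul_fixed_unique_of_sub_ne_zero σ hd0 (hfixP _ yz.1.2) (hfixP _ yz.2.2) hfy' hfz' hdec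
      exact ⟨⟨hyy ▸ hy', hfixP _ yz.1.2⟩, ⟨hzz ▸ hz', hfixP _ yz.2.2⟩⟩
    · rintro ⟨⟨hy, -⟩, ⟨hz, -⟩⟩
      have h := M.add_mem hy (M.smul_mem g hz)
      exact h
  have h1 : M.toAddSubgroup.relIndex On = (M.toAddSubgroup.addSubgroupOf On).index := rfl
  have h2' : Mσ.relIndex P = (Mσ.addSubgroupOf P).index := rfl
  rw [h1, h2', ← AddSubgroup.index_comap_of_surjective (M.toAddSubgroup.addSubgroupOf On) hΨsurj, hcomap, AddSubgroup.index_prod, sq]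

end GeneratorDescent

/-! ## §2 The two-field currency of ★ Σ2-F ∕ ★ O8a-5Σ: the additive index and the composed unit index from `hmove` alone -/

section TwoFields

variable {F E : Type*} [Field F] [ValuativeRel F] [Field E] [ValuativeRel E] {n : ℕ}
  (ι : F →+* E) (ιO : 𝒪[F] →+* 𝒪[E]) (σ : E →+* E)

/-- **Σ2-F (c) FROM `hmove` ALONE: `[𝒪_Fⁿ : RF]² = [𝒪_Eⁿ : R]`** — ★ `index_comap_adjoin_sq` with `(h2 : IsUnit (2 : 𝒪[E])) (δ) (hδ) (hσδ)` REPLACED by the inert token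
`hmove : ∃ a : 𝒪[E], IsUnit (σa − a)` (the generator of §1); statement otherwise VERBATIM. [cite: Serre1979, Ch. X §1 Prop. 3] [cite: Neukirch1999, Ch. I §12] -/
theorem index_comap_adjoin_sq_of_isUnit_sub (hιO : ∀ x : 𝒪[F], ((ιO x : 𝒪[E]) : E) = ι x)
    (hfixO : ∀ y : 𝒪[E], σ y = y → ∃ x, ιO x = y) (hσι : ∀ x : F, σ (ι x) = ι x)
    (hσσ : ∀ a, σ (σ a) = a) (hσO : ∀ a : 𝒪[E], σ a ∈ 𝒪[E]) (hmove : ∃ a : 𝒪[E], IsUnit ((⟨σ a, hσO a⟩ : 𝒪[E]) - a))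
    (γ : Fin n → E) (hσγ : ∀ x ∈ Algebra.adjoin 𝒪[E] ({γ} : Set (Fin n → E)), (fun i => σ (x i)) ∈ Algebra.adjoin 𝒪[E] ({γ} : Set (Fin n → E))) :
    ((Algebra.adjoin 𝒪[E] ({γ} : Set (Fin n → E))).toSubring.comap
        (RingHom.pi fun i : Fin n => ((𝒪[E]).subtype.comp ιO).comp (Pi.evalRingHom (fun _ : Fin n => 𝒪[F]) i))).toAddSubgroup.index ^ 2 =
      ((Algebra.adjoin 𝒪[E] ({γ} : Set (Fin n → E))).toSubring.comap
        (RingHom.pi fun i : Fin n => (𝒪[E]).subtype.comp (Pi.evalRingHom (fun _ : Fin n => 𝒪[E]) i))).toAddSubgroup.index := by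
  classical
  obtain ⟨g, hg⟩ := hmove
  set A : Subalgebra 𝒪[E] (Fin n → E) := Algebra.adjoin 𝒪[E] ({γ} : Set (Fin n → E)) with hA
  set M : Submodule 𝒪[E] (Fin n → E) := Subalgebra.toSubmodule A with hM
  set coen : (Fin n → 𝒪[E]) →+* (Fin n → E) := RingHom.pi fun i : Fin n => (𝒪[E]).subtype.comp (Pi.evalRingHom (fun _ : Fin n => 𝒪[E]) i) with hcoen
  set ιOn : (Fin n → 𝒪[F]) →+* (Fin n → E) := RingHom.pi fun i : Fin n => ((𝒪[E]).subtype.comp ιO).comp (Pi.evalRingHom (fun _ : Fin n => 𝒪[F]) i) with hιOn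
  set Fix : AddSubgroup (Fin n → E) :=
    (RingHom.eqLocus (RingHom.pi (fun i => σ.comp (Pi.evalRingHom (fun _ : Fin n => E) i))) (RingHom.id (Fin n → E))).toAddSubgroup with hFix
  set On : AddSubgroup (Fin n → E) := AddSubgroup.pi Set.univ fun _ : Fin n => (𝒪[E]).toAddSubgroup with hOn
  have memFix : ∀ x : Fin n → E, x ∈ Fix ↔ ∀ i, σ (x i) = x i := fun x => by
    rw [hFix, Subring.mem_toAddSubgroup, RingHom.mem_eqLocus]
    exact ⟨fun h i => by simpa using congrFun h i, fun h => funext fun i => by simpa using h i⟩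
  have memOn : ∀ x : Fin n → E, x ∈ On ↔ ∀ i, x i ∈ 𝒪[E] := fun x => by
    rw [hOn, AddSubgroup.mem_pi]; simp
  have hMA : M.toAddSubgroup = A.toSubring.toAddSubgroup := rfl
  -- §1 (the generator descent) in place of ★ O3 (b)
  have hMσ : ∀ x ∈ M, (fun i => σ (x i)) ∈ M := fun x hx => hσγ x hx
  have hO3 := relIndex_inf_fixed_sq_eq_relIndex_of_isUnit_sub σ 𝒪[E] hσσ (fun a ha => hσO ⟨a, ha⟩) g hg M hMσ
  -- the E-side transport along `coen` (injective, range `On`)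
  have hcoen_range : (⊤ : AddSubgroup (Fin n → 𝒪[E])).map coen.toAddMonoidHom = On := by
    ext y
    rw [AddSubgroup.mem_map, memOn]
    constructor
    · rintro ⟨x, -, rfl⟩ i
      exact (x i).2
    · intro hy
      exact ⟨fun i => ⟨y i, hy i⟩, AddSubgroup.mem_top _, funext fun i => rfl⟩
  have hRE : (A.toSubring.comap coen).toAddSubgroup = M.toAddSubgroup.comap coen.toAddMonoidHom := by
    ext x; exact Iff.rfl
  have hE : (A.toSubring.comap coen).toAddSubgroup.index = M.toAddSubgroup.relIndex On := by
    rw [← AddSubgroup.relIndex_top_right, hRE, AddSubgroup.relIndex_comap, hcoen_range]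
  -- the F-side transport along `ιOn` (injective, range `On ⊓ Fix`)
  have hιOn_range : (⊤ : AddSubgroup (Fin n → 𝒪[F])).map ιOn.toAddMonoidHom = On ⊓ Fix := by
    ext y
    rw [AddSubgroup.mem_map, AddSubgroup.mem_inf, memOn, memFix]
    constructor
    · rintro ⟨x, -, rfl⟩
      refine ⟨fun i => ?_, fun i => ?_⟩
      · exact (ιO (x i)).2
      · change σ (((ιO (x i) : 𝒪[E]) : E)) = ((ιO (x i) : 𝒪[E]) : E)
        rw [hιO, hσι]
    · rintro ⟨hyO, hyσ⟩
      have hex : ∀ i, ∃ x : 𝒪[F], ιO x = ⟨y i, hyO i⟩ := fun i => hfixO ⟨y i, hyO i⟩ (hyσ i)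
      choose x hx using hex
      refine ⟨x, AddSubgroup.mem_top _, funext fun i => ?_⟩
      change (((ιO (x i) : 𝒪[E]) : E)) = y i
      rw [hx i]
  have hRF : (A.toSubring.comap ιOn).toAddSubgroup = M.toAddSubgroup.comap ιOn.toAddMonoidHom := by
    ext x; exact Iff.rfl
  have hF : (A.toSubring.comap ιOn).toAddSubgroup.index = (M.toAddSubgroup ⊓ Fix).relIndex (On ⊓ Fix) := by
    rw [← AddSubgroup.relIndex_top_right, hRF, AddSubgroup.relIndex_comap, hιOn_range]
    have h1 : (M.toAddSubgroup ⊓ Fix) ⊓ (On ⊓ Fix) = M.toAddSubgroup ⊓ (On ⊓ Fix) := by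
      rw [inf_assoc, inf_left_comm Fix On Fix, inf_idem]
    rw [← AddSubgroup.inf_relIndex_right (M.toAddSubgroup ⊓ Fix), h1, AddSubgroup.inf_relIndex_right]
  rw [hF, hE]
  exact hO3

/-- **O8a-5Σ FROM `hmove` ALONE — THE COMPOSED INDEX `[C : R^×] = (q + 1)^{n−1} q^{S−(n−1)}`**: ★ `relIndex_units_adjoin_comap_norm_eq` with the binders
`(h2 : IsUnit (2 : 𝒪[E])) (δ) (hδ) (hσδ)` DELETED (its only use, ★ Σ2-F (c), now runs on `hmove` — `index_comap_adjoin_sq_of_isUnit_sub`); every other binder, the tokens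
`R^× := (adjoin 𝒪[E] {↑γ}).toSubmonoid.units`, `C := R^×.comap (id * Units.map σⁿ)` and the conclusion VERBATIM; proof = ★'s (`R^× ≤ C ≤ G`, ★ O8a-5E, ★ Σ2-F (d),
★ O2, cancel). [cite: Neukirch1999, Ch. I §12] [cite: Rogawski1990, §4.9 Lemma 4.9.3 p. 56] [cite: Serre1979, Ch. V §2 Prop. 3] -/
theorem relIndex_units_adjoin_comap_norm_eq_of_isUnit_sub [UniformSpace E] [IsUniformAddGroup E] [IsNonarchimedeanLocalField E]
    [IsDiscreteValuationRing 𝒪[E]] [Finite 𝓀[E]] [IsDiscreteValuationRing 𝒪[F]] [Finite 𝓀[F]]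
    (hιO : ∀ x : 𝒪[F], ((ιO x : 𝒪[E]) : E) = ι x) (hιinj : Function.Injective ιO)
    (hfixO : ∀ y : 𝒪[E], σ y = y → ∃ x, ιO x = y) (hσι : ∀ x : F, σ (ι x) = ι x)
    (hσσ : ∀ a, σ (σ a) = a) (hσO : ∀ a : 𝒪[E], σ a ∈ 𝒪[E]) (hmove : ∃ a : 𝒪[E], IsUnit ((⟨σ a, hσO a⟩ : 𝒪[E]) - a))
    (hιm : ∀ x : 𝒪[F], ιO x ∈ IsLocalRing.maximalIdeal 𝒪[E] → x ∈ IsLocalRing.maximalIdeal 𝒪[F])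
    (hq : Nat.card 𝓀[E] = Nat.card 𝓀[F] ^ 2) {ϖE : E} (hϖE : IsUniformizingElement ϖE)
    (hn : 0 < n) (γ : Fin n → 𝒪[E]) (N : Fin n → Fin n → ℕ) (hNpos : ∀ i j : Fin n, i < j → 0 < N i j)
    (hN : ∀ i j : Fin n, i < j → valuation E (((γ j : E) - γ i)) = valuation E ϖE ^ N i j)
    (hσγ : ∀ x ∈ Algebra.adjoin 𝒪[E] ({fun i => (γ i : E)} : Set (Fin n → E)),
      (fun i => σ (x i)) ∈ Algebra.adjoin 𝒪[E] ({fun i => (γ i : E)} : Set (Fin n → E))) :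
    ((Algebra.adjoin 𝒪[E] ({fun i => (γ i : E)} : Set (Fin n → E))).toSubmonoid.units).relIndex
        (((Algebra.adjoin 𝒪[E] ({fun i => (γ i : E)} : Set (Fin n → E))).toSubmonoid.units).comap
          (MonoidHom.id (Fin n → E)ˣ * (Units.map (RingHom.pi fun i : Fin n => σ.comp (Pi.evalRingHom (fun _ : Fin n => E) i)).toMonoidHom))) =
      (Nat.card 𝓀[F] + 1) ^ (n - 1) * Nat.card 𝓀[F] ^ ((∑ i : Fin n, ∑ j ∈ Ioi i, N i j) - (n - 1)) := by
  classical
  set γE : Fin n → E := fun i => (γ i : E) with hγE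
  have hγEO : ∀ i, γE i ∈ 𝒪[E] := fun i => (γ i).2
  set A : Subalgebra 𝒪[E] (Fin n → E) := Algebra.adjoin 𝒪[E] ({γE} : Set (Fin n → E)) with hA
  set Ru : Subgroup (Fin n → E)ˣ := A.toSubmonoid.units with hRu
  set Nh : (Fin n → E)ˣ →* (Fin n → E)ˣ :=
    MonoidHom.id (Fin n → E)ˣ * (Units.map (RingHom.pi fun i : Fin n => σ.comp (Pi.evalRingHom (fun _ : Fin n => E) i)).toMonoidHom) with hNh
  set C : Subgroup (Fin n → E)ˣ := Ru.comap Nh with hC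
  set coen : (Fin n → 𝒪[E]) →+* (Fin n → E) := RingHom.pi fun i : Fin n => (𝒪[E]).subtype.comp (Pi.evalRingHom (fun _ : Fin n => 𝒪[E]) i) with hcoen
  set G : Subgroup (Fin n → E)ˣ := (Units.map coen.toMonoidHom).range with hG
  set ιOn : (Fin n → 𝒪[F]) →+* (Fin n → E) := RingHom.pi fun i : Fin n => ((𝒪[E]).subtype.comp ιO).comp (Pi.evalRingHom (fun _ : Fin n => 𝒪[F]) i) with hιOn
  set RF : Subring (Fin n → 𝒪[F]) := A.toSubring.comap ιOn with hRF
  set S : ℕ := ∑ i : Fin n, ∑ j ∈ Ioi i, N i j with hSdef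
  have hRuC : Ru ≤ C := units_adjoin_le_comap_norm σ γE hσγ
  have hCG : C ≤ G := comap_norm_units_adjoin_le_range_unitsMap σ hσσ hσO hγEO
  -- `[G : Ru]` — ★ O8a-5E
  have hcoen' : coen.toMonoidHom = (((𝒪[E]).subtype.compLeft (Fin n)) : (Fin n → 𝒪[E]) →* (Fin n → E)) := by
    rw [hcoen, ringHom_pi_subtype_comp_eval_eq_compLeft, RingHom.toMonoidHom_eq_coe]
  have hGRu : Ru.relIndex G = (Nat.card 𝓀[E] - 1) ^ (n - 1) * Nat.card 𝓀[E] ^ (S - (n - 1)) := by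
    rw [hG, hcoen']
    exact relIndex_units_adjoin_range_unitsMap_eq hϖE hn γ N hNpos hN
  -- `[G : C] = [(𝒪_Fˣ)ⁿ : RF^×]` — ★ Σ2-F (d)
  have hGC : C.relIndex G = (Units.map RF.subtype.toMonoidHom).range.index :=
    relIndex_comap_norm_eq_index_units_fixedSide ι ιO σ hιO hιinj hfixO hσι hσσ hσO hmove γE
  -- ★ O2 at `RF`: constants (Σ2-F (a)), locality (Σ2-F (b)), index `q^S` (Σ2-F (c) through the generator + O1)
  have hconst : ∀ a : 𝒪[F], (fun _ : Fin n => a) ∈ RF := fun a => const_mem_comap_adjoin ιO γE a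
  have hγc : ∀ i j : Fin n, (⟨γE i, hγEO i⟩ : 𝒪[E]) - ⟨γE j, hγEO j⟩ ∈ IsLocalRing.maximalIdeal 𝒪[E] := by
    intro i j
    have hi : (⟨γE i, hγEO i⟩ : 𝒪[E]) = γ i := Subtype.ext rfl
    have hj : (⟨γE j, hγEO j⟩ : 𝒪[E]) = γ j := Subtype.ext rfl
    rw [hi, hj]
    rcases lt_trichotomy i j with h | rfl | h
    · have := mem_maximalIdeal_of_valuation_eq_pow hϖE (hNpos i j h) (x := γ j - γ i) (by push_cast; exact hN i j h)
      rw [← neg_sub]; exact (Ideal.neg_mem_iff _).2 this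
    · simp
    · exact mem_maximalIdeal_of_valuation_eq_pow hϖE (hNpos j i h) (x := γ i - γ j) (by push_cast; exact hN j i h)
  haveI : IsLocalRing RF := isLocalRing_comap_adjoin ιO hn hιm γE hγEO hγc
  have hRE : (A.toSubring.comap coen).toAddSubgroup.index = Nat.card 𝓀[E] ^ S := by
    rw [hcoen, ringHom_pi_subtype_comp_eval_eq_compLeft, hA, hγE, comap_compLeft_adjoin_coe_toSubring_eq γ]
    exact index_adjoin_singleton_eq_pow_sum hϖE γ N hN
  have hsq := index_comap_adjoin_sq_of_isUnit_sub ι ιO σ hιO hfixO hσι hσσ hσO hmove γE hσγ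
  have hS : RF.toAddSubgroup.index = Nat.card 𝓀[F] ^ S := by
    rw [hRE, hq, ← pow_mul, mul_comm, pow_mul] at hsq
    exact Nat.pow_left_injective two_ne_zero hsq
  have hO2 := (index_range_units_map_eq_of_index_eq_pow RF hconst hS).2
  -- assemble: `[C : Ru]·[G : C] = [G : Ru]`
  have hmul := Subgroup.relIndex_mul_relIndex Ru C G hRuC hCG
  rw [hGC, hGRu, RingHom.toMonoidHom_eq_coe, hO2, hq] at hmul
  have hq1 : 1 < Nat.card 𝓀[F] := Finite.one_lt_card
  obtain ⟨p, hp⟩ : ∃ p, Nat.card 𝓀[F] = p + 1 := ⟨Nat.card 𝓀[F] - 1, by omega⟩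
  rw [hp] at hmul ⊢
  set X := Ru.relIndex C
  set a := n - 1
  set T := S - (n - 1)
  have hsub1 : p + 1 - 1 = p := Nat.add_sub_cancel p 1
  have hsub2 : (p + 1) ^ 2 - 1 = p * (p + 2) := by
    have : (p + 1) ^ 2 = p * (p + 2) + 1 := by ring
    rw [this, Nat.add_sub_cancel]
  rw [hsub1] at hmul
  rw [hsub2, mul_pow, ← pow_mul, two_mul, pow_add] at hmul
  have key : X * (p ^ a * (p + 1) ^ T) = ((p + 1 + 1) ^ a * (p + 1) ^ T) * (p ^ a * (p + 1) ^ T) := by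
    rw [hmul]; ring
  exact Nat.eq_of_mul_eq_mul_right (Nat.mul_pos (pow_pos (by omega) _) (pow_pos (by omega) _)) key

end TwoFields

/-! ## §3 At an inert-UNRAMIFIED place of a quadratic extension of number fields, EVERY residue characteristic -/

section Place

open UnitaryGroup

variable {F E : Type} [Field F] [NumberField F] [Field E] [NumberField E] [Algebra F E]
  [Algebra.IsQuadraticExtension F E] (c : E ≃ₐ[F] E) (v : HeightOneSpectrum (𝓞 F)) {n : ℕ}

/-- **(U2) THE COMPOSED UNIT INDEX AT AN INERT-UNRAMIFIED PLACE, ANY RESIDUE CHARACTERISTIC** (ROW-2 value of the depth-zero κ-transfer, type (1), at `v ∣ 2` included):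
for deep regular nodes `γ ∈ 𝒪[E_w]ⁿ` (`|γ_j − γ_i|_w = |ϖ|_w^{N i j}`, `N i j ≥ 1`) with `𝒪_w[γ]` stable under `σ_w`, in O8a-1's tokens `R^× := (adjoin 𝒪[E_w] {γ}).toSubmonoid.units`,
`C := R^×.comap (id · σ_w)`: `[C : R^×] = (N(v) + 1)^{n−1} · N(v)^{Σ_{i<j} N i j − (n−1)}` — ★ `relIndex_units_adjoin_comap_norm_eq_place` :239 with the binder
`(h2 : Valued.v (2 : E_w) = 1)` DELETED and nothing added (`hc hunr w hw ιO hιO hϖE hn γ N hNpos hN hσγ` and the conclusion VERBATIM); the (C6)-2∕-3 ROW-2 readers dock here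
by name (CENSUS-C6 196c9bc3 §0.3′; FINDING #15). [cite: Rogawski1990, §4.9 Lemma 4.9.3 p. 56] [cite: Serre1979, Ch. V §2 Prop. 3] [cite: Neukirch1999, Ch. I §12] -/
theorem relIndex_units_adjoin_comap_norm_eq_place_of_isUnramifiedIn (hc : c ≠ 1) (hunr : Algebra.IsUnramifiedIn (𝓞 E) v.asIdeal)
    (w : UnitaryGroup.PlacesOver E v) (hw : c • w.1 = w.1)
    (ιO : 𝒪[v.adicCompletion F] →+* 𝒪[w.1.adicCompletion E])
    (hιO : ∀ x : 𝒪[v.adicCompletion F], ((ιO x : 𝒪[w.1.adicCompletion E]) : w.1.adicCompletion E) = UnitaryGroup.toPlace v w x)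
    {ϖE : w.1.adicCompletion E} (hϖE : IsUniformizingElement ϖE) (hn : 0 < n) (γ : Fin n → 𝒪[w.1.adicCompletion E])
    (N : Fin n → Fin n → ℕ) (hNpos : ∀ i j : Fin n, i < j → 0 < N i j)
    (hN : ∀ i j : Fin n, i < j →
      valuation (w.1.adicCompletion E) ((γ j : w.1.adicCompletion E) - γ i) = valuation (w.1.adicCompletion E) ϖE ^ N i j)
    (hσγ : ∀ x ∈ Algebra.adjoin 𝒪[w.1.adicCompletion E] ({fun i => (γ i : w.1.adicCompletion E)} : Set (Fin n → w.1.adicCompletion E)),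
      (fun i => galAdicCompletionMap (L := E) c hw (x i)) ∈
        Algebra.adjoin 𝒪[w.1.adicCompletion E] ({fun i => (γ i : w.1.adicCompletion E)} : Set (Fin n → w.1.adicCompletion E))) :
    ((Algebra.adjoin 𝒪[w.1.adicCompletion E] ({fun i => (γ i : w.1.adicCompletion E)} : Set (Fin n → w.1.adicCompletion E))).toSubmonoid.units).relIndex
        (((Algebra.adjoin 𝒪[w.1.adicCompletion E]
            ({fun i => (γ i : w.1.adicCompletion E)} : Set (Fin n → w.1.adicCompletion E))).toSubmonoid.units).comap
          (MonoidHom.id (Fin n → w.1.adicCompletion E)ˣ *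
            (Units.map (RingHom.pi fun i : Fin n => (galAdicCompletionMap (L := E) c hw).comp
              (Pi.evalRingHom (fun _ : Fin n => w.1.adicCompletion E) i)).toMonoidHom))) =
      (Ideal.absNorm v.asIdeal + 1) ^ (n - 1) * Ideal.absNorm v.asIdeal ^ ((∑ i : Fin n, ∑ j ∈ Ioi i, N i j) - (n - 1)) := by
  rw [← natCard_residueField_eq_absNorm v]
  exact relIndex_units_adjoin_comap_norm_eq_of_isUnit_sub (UnitaryGroup.toPlace v w) ιO (galAdicCompletionMap (L := E) c hw) hιO
    (injective_of_coe_eq_toPlace v w ιO hιO) (exists_map_eq_of_galAdicCompletionMap_eq v w c hc hw ιO hιO)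
    (galAdicCompletionMap_toPlace c w w hw) (galAdicCompletionMap_galAdicCompletionMap_of_smul_eq c w hc hw)
    (mem_integer_galAdicCompletionMap c v w hw) (exists_isUnit_galAdicCompletionMap_sub c v hc hunr w hw)
    (fun x hx => mem_maximalIdeal_of_map_mem_maximalIdeal ιO x hx)
    (natCard_residueField_eq_natCard_residueField_sq c v hc hunr w hw) hϖE hn γ N hNpos hN hσγ

end Place

end Literature.NumberTheory.Automorphic

end
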